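import Literature.Probability.RandomPlanarGeometry.SAWCountMonotoneEscape
import HarnessLib

/-!
# Monotonicity `cₙ ≤ cₙ₊₁` (O'Brien 1990): the escape injection with an explicit step selector, and the
# SPARE-WALK SOCKET `cₙ ≤ cₙ₊₁ + #(R \ S)` for any injection of `S ⊆ R` into spare free-ended walks

Sequel of `SAWCountMonotoneEscape.lean` (`cₙ ≤ cₙ₊₁ + #R` by the escape injection `escapeMap`: prolong a free
end along an escape route, prepend a free start site to a doomed end).  There the escape step is a
`Classical.choose`, so no particular `(n+1)`-step walk is provably OUTSIDE the image.  Here the step is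
taken by an explicit **selector** `sel` (`IsEscapeSelector n sel`: `sel ω` starts an escape route whenever the
end of `ω` is free, and depends on `ω` only through `ω 0, …, ω n`; selectors exist, `exists_escapeSelector`).
Then every free-ended IMAGE `η` satisfies `η (n+1) = sel η` (`escapeMapSel_apply_succ`), so every free-ended
`(n+1)`-step walk `η` with `η (n+1) ≠ sel η` is SPARE, and any injective assignment of residual walks to spare
walks sharpens the reduction:

* `count_le_count_succ_add_card_sdiff_of_spare` : **`cₙ ≤ cₙ₊₁ + #(R \ S)`** for every `S ⊆ R = escapeResidual d n`
  carrying an injective `Ψ : S → {η ∈ 𝒲ₙ₊₁ : end free, η (n+1) ≠ sel η}`;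
* `count_le_count_succ_of_spare` : O'Brien's inequality as soon as all of `R` is so assigned.

This is the socket for a third rule of an O'Brien-type injection acting on the residual class (both ends
stuck; by `SAWCountMonotoneEscapeOdd.lean` the residual is empty exactly for `n ≤ 6d - 3` odd / `8d - 6` even and
consists of both-trapped walks at the first odd lengths beyond).  Lane construction; vocabulary of
Madras–Slade §1.1.

[cite: MadrasSlade1993, §1.1; §7.1 p. 231 (`c_{N+1} ≥ c_N`, O'Brien)] [cite: BDGS2012, §1.3 (`cₙ ≤ cₙ₊₁`, O'Brien 1990)]
-/

noncomputable section

open Literature.Probability.LatticeModels Literature.Probability.Percolation SimpleGraph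

namespace Literature.Probability.RandomPlanarGeometry.SAW.Zd

variable {d : ℕ}

/-! ### Escape routes depend on the walk only up to time `n` -/

/-- `IsEscape` only reads `ω 0, …, ω n`. [cite: MadrasSlade1993, §1.1] -/
theorem isEscape_congr {ω₁ ω₂ : ℕ → Site d} {n : ℕ} (h : ∀ i ≤ n, ω₁ i = ω₂ i) (P : ℕ → Site d) :
    IsEscape ω₁ n P ↔ IsEscape ω₂ n P := by
  unfold IsEscape
  rw [h n le_rfl]
  refine and_congr_right fun _ => and_congr_right fun _ => and_congr_right fun _ => ?_
  refine forall_congr' fun i => forall_congr' fun j => forall_congr' fun hj => ?_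
  rw [h j hj]

/-- `EndFree` only reads `ω 0, …, ω n`. [cite: MadrasSlade1993, §1.1] -/
theorem endFree_congr {ω₁ ω₂ : ℕ → Site d} {n : ℕ} (h : ∀ i ≤ n, ω₁ i = ω₂ i) :
    EndFree ω₁ n ↔ EndFree ω₂ n :=
  exists_congr fun P => isEscape_congr h P

/-! ### Escape-step selectors -/

/-- An **escape-step selector** at time `n`: `sel ω` is the first site of an escape route whenever the end
of `ω` is free, and `sel` depends on `ω` only through `ω 0, …, ω n`. [cite: MadrasSlade1993, §1.1] -/
structure IsEscapeSelector (n : ℕ) (sel : (ℕ → Site d) → Site d) : Prop where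
  /-- the selected site starts an escape route -/
  escapes : ∀ ω : ℕ → Site d, EndFree ω n → ∃ P, IsEscape ω n P ∧ P 0 = sel ω
  /-- the selection only reads the walk up to time `n` -/
  congr : ∀ ω₁ ω₂ : ℕ → Site d, (∀ i ≤ n, ω₁ i = ω₂ i) → sel ω₁ = sel ω₂

/-- **Selectors exist** (choose an escape route of the walk frozen at time `n`). [cite: MadrasSlade1993, §1.1] -/
theorem exists_escapeSelector (n : ℕ) : ∃ sel : (ℕ → Site d) → Site d, IsEscapeSelector (d := d) n sel := by
  classical
  have hres : ∀ ω : ℕ → Site d, ∀ i ≤ n, restrictTo ω n i = ω i := fun ω i hi => by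
    rw [restrictTo_apply, min_eq_left hi]
  set pick : (ℕ → Site d) → Site d := fun ρ => if h : EndFree ρ n then Classical.choose h 0 else 0
    with hpick
  refine ⟨fun ω => pick (restrictTo ω n), ?_, ?_⟩
  · intro ω hω
    have h' : EndFree (restrictTo ω n) n := (endFree_congr (hres ω)).2 hω
    refine ⟨Classical.choose h', (isEscape_congr (hres ω) _).1 (Classical.choose_spec h'), ?_⟩
    show Classical.choose h' 0 = pick (restrictTo ω n)
    rw [hpick]; simp only [dif_pos h']
  · intro ω₁ ω₂ h
    have : restrictTo ω₁ n = restrictTo ω₂ n := funext fun i => by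
      rw [restrictTo_apply, restrictTo_apply]; exact h (min i n) (min_le_right _ _)
    show pick (restrictTo ω₁ n) = pick (restrictTo ω₂ n)
    rw [this]

/-- The selected site is a free extension. [cite: MadrasSlade1993, §1.1] -/
theorem IsEscapeSelector.mem_freeNbrs {n : ℕ} {sel : (ℕ → Site d) → Site d} (hs : IsEscapeSelector n sel)
    {ω : ℕ → Site d} (hω : EndFree ω n) : sel ω ∈ freeNbrs ω n := by
  obtain ⟨P, hP, h0⟩ := hs.escapes ω hω
  rw [← h0]; exact hP.apply_zero_mem_freeNbrs

/-! ### The escape injection with selector `sel` -/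

open Classical in
/-- **The escape injection with selector `sel`**: prolong a free end by `sel ω`, else prepend a free start
site (junk value `ω` on the residual). [cite: BDGS2012, §1.3] -/
def escapeMapSel (sel : (ℕ → Site d) → Site d) (n : ℕ) (ω : ℕ → Site d) : ℕ → Site d :=
  if EndFree ω n then extendTo ω n (sel ω)
  else if h' : (freeNbrs (revWalk n ω) n).Nonempty then prependVia n ω (Classical.choose h') else ω

open Classical in
/-- Images lie in the `(n+1)`-step self-avoiding walks. [cite: BDGS2012, §1.3] -/
theorem escapeMapSel_mem_saws {n : ℕ} {sel : (ℕ → Site d) → Site d} (hs : IsEscapeSelector n sel)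
    {ω : ℕ → Site d} (hω : ω ∈ saws d n) (hR : ω ∉ escapeResidual d n) :
    escapeMapSel sel n ω ∈ saws d (n + 1) := by
  unfold escapeMapSel
  split_ifs with h h'
  · exact extendTo_mem_saws hω (hs.mem_freeNbrs h)
  · exact prependVia_mem_saws hω (Classical.choose_spec h')
  · exfalso
    refine hR (mem_escapeResidual.2 ⟨hω, h, ?_⟩)
    rw [extCount, Finset.card_eq_zero]
    exact Finset.not_nonempty_iff_eq_empty.1 h'

open Classical in
/-- Image of a free-ended walk: free end. [cite: BDGS2012, §1.3] -/
theorem endFree_escapeMapSel {n : ℕ} {sel : (ℕ → Site d) → Site d} (hs : IsEscapeSelector n sel)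
    {ω : ℕ → Site d} (h : EndFree ω n) : EndFree (escapeMapSel sel n ω) (n + 1) := by
  unfold escapeMapSel
  rw [if_pos h]
  obtain ⟨P, hP, h0⟩ := hs.escapes ω h
  rw [← h0]
  exact endFree_extendTo hP

open Classical in
/-- **Image of a free-ended walk: its last site is the selected step of the image itself** (the image
agrees with `ω` up to time `n`). [cite: BDGS2012, §1.3] -/
theorem escapeMapSel_apply_succ {n : ℕ} {sel : (ℕ → Site d) → Site d} (hs : IsEscapeSelector n sel)
    {ω : ℕ → Site d} (h : EndFree ω n) :
    escapeMapSel sel n ω (n + 1) = sel (escapeMapSel sel n ω) := by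
  unfold escapeMapSel
  rw [if_pos h, extendTo_of_lt (Nat.lt_succ_self n)]
  exact hs.congr _ _ fun i hi => (extendTo_of_le hi).symm

open Classical in
/-- Image of a doomed-ended walk: doomed end. [cite: BDGS2012, §1.3] -/
theorem not_endFree_escapeMapSel {n : ℕ} (sel : (ℕ → Site d) → Site d) {ω : ℕ → Site d}
    (hω : ω ∈ saws d n) (h : ¬ EndFree ω n) : ¬ EndFree (escapeMapSel sel n ω) (n + 1) := by
  unfold escapeMapSel
  rw [if_neg h]
  split_ifs with h'
  · exact not_endFree_prependVia hω _ h
  · intro hf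
    apply h
    obtain ⟨-, hend, -, -⟩ := mem_saws.1 hω
    refine endFree_of_translate (ω := ω) (ω' := ω) (n := n + 1) (n' := n) 0
      (by rw [add_zero, hend (n + 1) (by omega)]) (fun j hj => ⟨j, by omega, by rw [add_zero]⟩) hf

open Classical in
/-- **The selector injection is injective** outside `R`. [cite: BDGS2012, §1.3] -/
theorem escapeMapSel_injOn {n : ℕ} {sel : (ℕ → Site d) → Site d} (hs : IsEscapeSelector n sel) :
    Set.InjOn (escapeMapSel sel n) ↑((saws d n).filter fun ω => ω ∉ escapeResidual d n) := by
  intro ω₁ h₁ ω₂ h₂ heq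
  obtain ⟨hs₁, hR₁⟩ := Finset.mem_filter.1 (Finset.mem_coe.1 h₁)
  obtain ⟨hs₂, hR₂⟩ := Finset.mem_filter.1 (Finset.mem_coe.1 h₂)
  by_cases hf₁ : EndFree ω₁ n <;> by_cases hf₂ : EndFree ω₂ n
  · have e : extendTo ω₁ n (sel ω₁) = extendTo ω₂ n (sel ω₂) := by
      have := heq; unfold escapeMapSel at this; rwa [if_pos hf₁, if_pos hf₂] at this
    rw [← restrictTo_extendTo hs₁ (sel ω₁), ← restrictTo_extendTo hs₂ (sel ω₂), e]
  · exact absurd ((heq ▸ endFree_escapeMapSel hs hf₁ : EndFree (escapeMapSel sel n ω₂) (n + 1)))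
      (not_endFree_escapeMapSel sel hs₂ hf₂)
  · exact absurd ((heq.symm ▸ endFree_escapeMapSel hs hf₂ : EndFree (escapeMapSel sel n ω₁) (n + 1)))
      (not_endFree_escapeMapSel sel hs₁ hf₁)
  · have hn₁ : (freeNbrs (revWalk n ω₁) n).Nonempty := by
      by_contra hc
      exact hR₁ (mem_escapeResidual.2 ⟨hs₁, hf₁, by
        rw [extCount, Finset.card_eq_zero]; exact Finset.not_nonempty_iff_eq_empty.1 hc⟩)
    have hn₂ : (freeNbrs (revWalk n ω₂) n).Nonempty := by
      by_contra hc
      exact hR₂ (mem_escapeResidual.2 ⟨hs₂, hf₂, by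
        rw [extCount, Finset.card_eq_zero]; exact Finset.not_nonempty_iff_eq_empty.1 hc⟩)
    have e : prependVia n ω₁ (Classical.choose hn₁) = prependVia n ω₂ (Classical.choose hn₂) := by
      have := heq; unfold escapeMapSel at this
      rwa [if_neg hf₁, if_neg hf₂, dif_pos hn₁, dif_pos hn₂] at this
    exact prependVia_injOn hs₁ hs₂ (Classical.choose_spec hn₁) (Classical.choose_spec hn₂) e

/-! ### The spare-walk socket -/

open Classical in
/-- **`cₙ ≤ cₙ₊₁ + #(R \ S)` from an injection of `S` into spare walks.**  Let `sel` be an escape-step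
selector and `Ψ` map every `ω ∈ S` (typically `S ⊆ R = escapeResidual d n`; not needed) injectively to an
`(n+1)`-step self-avoiding walk with a FREE end whose last site is NOT the selected step,
`Ψ ω (n+1) ≠ sel (Ψ ω)`.  Such walks are missed by the selector injection (`escapeMapSel_apply_succ`), so the
two maps glue to an injection of `(𝒲ₙ \ R) ∪ S` into `𝒲ₙ₊₁`. [cite: BDGS2012, §1.3] -/
theorem count_le_count_succ_add_card_sdiff_of_spare {n : ℕ} {sel : (ℕ → Site d) → Site d}
    (hs : IsEscapeSelector n sel) (S : Finset (ℕ → Site d)) (Ψ : (ℕ → Site d) → ℕ → Site d)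
    (hΨ : ∀ ω ∈ S, Ψ ω ∈ saws d (n + 1) ∧ EndFree (Ψ ω) (n + 1) ∧ Ψ ω (n + 1) ≠ sel (Ψ ω))
    (hinj : Set.InjOn Ψ ↑S) :
    count d n ≤ count d (n + 1) + (escapeResidual d n \ S).card := by
  classical
  set R := escapeResidual d n with hR
  have hRsub : R ⊆ saws d n := fun ω hω => (mem_escapeResidual.1 hω).1
  -- the glued map on `D = (𝒲ₙ \ R) ∪ S`
  set D := (saws d n).filter fun ω => ω ∉ R ∨ ω ∈ S with hD
  set Φ : (ℕ → Site d) → ℕ → Site d := fun ω => if ω ∈ S then Ψ ω else escapeMapSel sel n ω with hΦ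
  have hmaps : ∀ ω ∈ D, Φ ω ∈ saws d (n + 1) := by
    intro ω hω
    obtain ⟨hω, h⟩ := Finset.mem_filter.1 hω
    by_cases hωS : ω ∈ S
    · rw [hΦ]; simp only [if_pos hωS]; exact (hΨ ω hωS).1
    · rw [hΦ]; simp only [if_neg hωS]
      exact escapeMapSel_mem_saws hs hω (h.resolve_right hωS)
  have hinjΦ : Set.InjOn Φ ↑D := by
    intro ω₁ h₁ ω₂ h₂ heq
    obtain ⟨hω₁, h₁'⟩ := Finset.mem_filter.1 (Finset.mem_coe.1 h₁)
    obtain ⟨hω₂, h₂'⟩ := Finset.mem_filter.1 (Finset.mem_coe.1 h₂)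
    have key : ∀ ω₁ ω₂, ω₁ ∈ S → ω₂ ∈ saws d n → ω₂ ∉ R → Ψ ω₁ ≠ escapeMapSel sel n ω₂ := by
      intro ω₁ ω₂ hS₁ hω₂ hR₂ h
      obtain ⟨-, hfree, hlast⟩ := hΨ ω₁ hS₁
      by_cases hf : EndFree ω₂ n
      · apply hlast
        rw [h]; exact escapeMapSel_apply_succ hs hf
      · exact not_endFree_escapeMapSel sel hω₂ hf (h ▸ hfree)
    by_cases hS₁ : ω₁ ∈ S <;> by_cases hS₂ : ω₂ ∈ S
    · rw [hΦ] at heq; simp only [if_pos hS₁, if_pos hS₂] at heq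
      exact hinj (Finset.mem_coe.2 hS₁) (Finset.mem_coe.2 hS₂) heq
    · rw [hΦ] at heq; simp only [if_pos hS₁, if_neg hS₂] at heq
      exact absurd heq (key ω₁ ω₂ hS₁ hω₂ (h₂'.resolve_right hS₂))
    · rw [hΦ] at heq; simp only [if_neg hS₁, if_pos hS₂] at heq
      exact absurd heq.symm (key ω₂ ω₁ hS₂ hω₁ (h₁'.resolve_right hS₁))
    · rw [hΦ] at heq; simp only [if_neg hS₁, if_neg hS₂] at heq
      exact escapeMapSel_injOn hs
        (Finset.mem_coe.2 (Finset.mem_filter.2 ⟨hω₁, h₁'.resolve_right hS₁⟩))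
        (Finset.mem_coe.2 (Finset.mem_filter.2 ⟨hω₂, h₂'.resolve_right hS₂⟩)) heq
  have hcardD : D.card ≤ (saws d (n + 1)).card := Finset.card_le_card_of_injOn Φ hmaps hinjΦ
  -- `#𝒲ₙ = #D + #(R \ S)`
  have hsplit : (saws d n).card = D.card + (R \ S).card := by
    have h1 := Finset.card_filter_add_card_filter_not (s := saws d n) (fun ω => ω ∉ R ∨ ω ∈ S)
    have h2 : ((saws d n).filter fun ω => ¬ (ω ∉ R ∨ ω ∈ S)) = R \ S := by
      ext ω
      simp only [Finset.mem_filter, Finset.mem_sdiff, not_or, not_not]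
      exact ⟨fun h => ⟨h.2.1, h.2.2⟩, fun h => ⟨hRsub h.1, h.1, h.2⟩⟩
    rw [← h1, h2]
  rw [← card_saws, ← card_saws, hsplit]
  omega

open Classical in
/-- **O'Brien's inequality from a complete spare assignment**: if every residual walk is injectively
assigned a free-ended `(n+1)`-step walk whose last site is not its selected step, then `cₙ ≤ cₙ₊₁`.
[cite: BDGS2012, §1.3] -/
theorem count_le_count_succ_of_spare {n : ℕ} {sel : (ℕ → Site d) → Site d} (hs : IsEscapeSelector n sel)
    (Ψ : (ℕ → Site d) → ℕ → Site d)
    (hΨ : ∀ ω ∈ escapeResidual d n,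
      Ψ ω ∈ saws d (n + 1) ∧ EndFree (Ψ ω) (n + 1) ∧ Ψ ω (n + 1) ≠ sel (Ψ ω))
    (hinj : Set.InjOn Ψ ↑(escapeResidual d n)) : count d n ≤ count d (n + 1) := by
  have := count_le_count_succ_add_card_sdiff_of_spare hs (escapeResidual d n) Ψ hΨ hinj
  rw [Finset.sdiff_self, Finset.card_empty, add_zero] at this
  exact this

open Classical in
/-- Sanity check: with `S = ∅` the socket is the plain escape reduction `cₙ ≤ cₙ₊₁ + #R`.
[cite: BDGS2012, §1.3] -/
theorem count_le_count_succ_add_card_escapeResidual_of_selector {n : ℕ} {sel : (ℕ → Site d) → Site d}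
    (hs : IsEscapeSelector n sel) : count d n ≤ count d (n + 1) + (escapeResidual d n).card := by
  have := count_le_count_succ_add_card_sdiff_of_spare hs ∅ (fun ω => ω)
    (fun ω hω => absurd hω (Finset.notMem_empty ω)) (fun _ h => absurd (Finset.mem_coe.1 h) (Finset.notMem_empty _))
  rw [Finset.sdiff_empty] at this
  exact this

end Literature.Probability.RandomPlanarGeometry.SAW.Zd
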